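/-
Origin: expansion seat `planner-pub-hodgecm-pv04-g6-0`, handover #4 2026-08-18T09:39:18Z (`HOME/pub-hodgecm-pv04-g6/lean/Pv04g6/CMInflationIndependentBlocks.lean`, md5 7226cdec, 372 lines);
landed by the gen-7 packager in gate run 27 as `HodgeCM/Model/Toy/CMInflationIndependentBlocks.lean` (import ^import Pv04g6\.CMInflationIndependentLedger\b→import HodgeCM.Model.Toy.CMInflationIndependentLedger ×1).
-/
/-
Copyright: pub-hodgecm cell (HodgeCMPerL). Consistency-witness layer (part (e)); FACTS.md §1c row (M38), column P5.
Origin: HOME/pub-hodgecm-pv04-g6/lean/Pv04g6/CMInflationIndependentBlocks.lean (WIP module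
`Pv04g6.CMInflationIndependentBlocks`; intended final place `HodgeCM/Model/Toy/CMInflationIndependentBlocks.lean` =
module `HodgeCM.Model.Toy.CMInflationIndependentBlocks`, CONTRIBUTING §3 kind L5) (seat planner-pub-hodgecm-pv04-g6-0,
DAG-node prover #04 gen 6, seam S6 / fact row M38).
WIP import to rewrite on landing: `import Pv04g6.CMInflationIndependentLedger` ↦ `import HodgeCM.Model.Toy.CMInflationIndependentLedger`.
-/
import Summits.HodgeConjecture.HodgeCM.Model.Toy.CMInflationIndependentLedger
import Summits.HodgeConjecture.HodgeCM.Model.Toy.ToyGysinDescent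
import Summits.HodgeConjecture.HodgeCM.Model.Toy.ToyF2

/-!
# M38 is independent of the block facts too (F2, F7, F7d = M41)

Completes `CMInflationIndependentLedger.lean`: the facts F7 `Fact_gysin` and F7d (M41) `Fact_gysinDescent`, which
quantify over BLOCK PAIRS `(p_Y, p_{Y'})` of a concatenated CM product `P = Y × Y'`, also pass from a universe
`U` to any morphism restriction `U.restrict C` (`restrict_fact_gysin`, `restrict_fact_gysinDescent`); F2
`Fact_factorActDescends` passes provided every endomorphism of a CM product lies in the class
(`restrict_fact_factorActDescends`), which holds for the tagged class of the toy (all atoms of `∏_j A_{(F,Θ_j)}` carry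
the one tag `N_F`).  Hence (`cmInflation_independent_blocks`)

  `∃ U, (U.ModelAxioms ∧ N1 ∧ N2 ∧ N3 ∧ N4 ∧ F2 ∧ F4 ∧ F5 ∧ F7 ∧ F7d ∧ D ∧ Fact_H0_rank) ∧ ¬ U.Fact_cmInflation`:

M38 is independent of M1–M28 ∧ N1–N4 ∧ F2 ∧ F4 ∧ F5 ∧ F7 ∧ M41 ∧ M40 ∧ M42 jointly — of every candidate fact of
`HOME/FACTS.md` §1c that holds in the exterior toy universe (F6 and T/T-CM fail there).

Method.  The iterated product `prodFin` and its projections `prj` are recursive in the number of factors, so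
`(U.restrict C).prodFin n X = U.prodFin n X` is only a propositional equality (`restrict_prodFin`) and the projections
agree up to `HEq` (`restrict_prj_heq`).  The three facts are therefore restated over an explicit BLOCK DATUM (objects
`P, Y, Y'` and the pull-back families of the factor projections) — `BlockBody` / `F2Body`, definitionally equal to the
facts (`fact_gysin_iff_blockBody`, …) — and transported along the componentwise (`Eq`/`HEq`) identification of the data
(`blockBody_congr`, `f2Body_congr`).
-/

noncomputable section

namespace HodgeCM

namespace Universe

variable (U : Universe) (C : U.MorClass)

/-! ### `HEq` toolkit: projections and pull-back families of a morphism restriction -/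

/-- (Ported verbatim from the HodgeCMPerL package; no docstring in the source.) -/
theorem heq_snd_of_eq {A A' : U.Var} (e : A = A') (B : U.Var) : HEq (U.snd A B) (U.snd A' B) := by
  subst e; exact HEq.rfl

/-- (Ported verbatim from the HodgeCMPerL package; no docstring in the source.) -/
theorem heq_comp_fst_of_heq {A A' : U.Var} (e : A = A') (B : U.Var) {T : U.Var} {p : U.Mor A T} {p' : U.Mor A' T}
    (h : HEq p p') : HEq (U.comp (U.fst A B) p) (U.comp (U.fst A' B) p') := by
  subst e; cases h; exact HEq.rfl

/-- The factor projections of `U.restrict C` are those of `U`, up to `restrict_prodFin`. -/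
theorem restrict_prj_heq (n : ℕ) (X : Fin (n + 1) → U.Var) (j : Fin (n + 1)) :
    HEq ((U.restrict C).prj n X j).1 (U.prj n X j) := by
  induction n with
  | zero =>
    cases j using Fin.lastCases with
    | last => simp only [prj, Fin.lastCases_last]; exact HEq.rfl
    | cast i => exact i.elim0
  | succ n ih =>
    cases j using Fin.lastCases with
    | last =>
      simp only [prj, Fin.lastCases_last]
      exact U.heq_snd_of_eq (U.restrict_prodFin C n _) _
    | cast i =>
      simp only [prj, Fin.lastCases_castSucc]
      exact U.heq_comp_fst_of_heq (U.restrict_prodFin C n _) _ (ih _ i)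

/-- (Ported verbatim from the HodgeCMPerL package; no docstring in the source.) -/
theorem heq_pullFamily {ι : Type} (T : ι → U.Var) {P P' : U.Var} (e : P' = P)
    (q' : ∀ i, U.Mor P' (T i)) (q : ∀ i, U.Mor P (T i)) (h : ∀ i, HEq (q' i) (q i)) :
    HEq (fun i k => U.pull (q' i) k) (fun i k => U.pull (q i) k) := by
  subst e
  obtain rfl : q' = q := funext fun i => eq_of_heq (h i)
  exact HEq.rfl

/-- (Ported verbatim from the HodgeCMPerL package; no docstring in the source.) -/
theorem heq_pullFamily₁ {ι : Type} (T : ι → U.Var) {P P' : U.Var} (e : P' = P)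
    (q' : ∀ i, U.Mor P' (T i)) (q : ∀ i, U.Mor P (T i)) (h : ∀ i, HEq (q' i) (q i)) (k : ℕ) :
    HEq (fun i => U.pull (q' i) k) (fun i => U.pull (q i) k) := by
  subst e
  obtain rfl : q' = q := funext fun i => eq_of_heq (h i)
  exact HEq.rfl

/-- all-degree pull-back families of (re-indexed) factor projections: `U.restrict C` versus `U` -/
theorem restrict_prjPull_heq (n : ℕ) (X : Fin (n + 1) → U.Var) {ι : Type} (σ : ι → Fin (n + 1)) :
    HEq (fun i k => (U.restrict C).pull ((U.restrict C).prj n X (σ i)) k) (fun i k => U.pull (U.prj n X (σ i)) k) :=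
  U.heq_pullFamily (fun i => X (σ i)) (U.restrict_prodFin C n X) (fun i => ((U.restrict C).prj n X (σ i)).1)
    (fun i => U.prj n X (σ i)) (fun i => U.restrict_prj_heq C n X (σ i))

/-- the same in one degree -/
theorem restrict_prjPull_heq₁ (n : ℕ) (X : Fin (n + 1) → U.Var) (k : ℕ) :
    HEq (fun i => (U.restrict C).pull ((U.restrict C).prj n X i) k) (fun i => U.pull (U.prj n X i) k) :=
  U.heq_pullFamily₁ X (U.restrict_prodFin C n X) (fun i => ((U.restrict C).prj n X i).1) (fun i => U.prj n X i)
    (fun i => U.restrict_prj_heq C n X i) k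

/-! ### Block data and the bodies of F7 / F7d -/

section Bodies

variable (P Y Y' : U.Var) {ιA ιB : Type} (TA : ιA → U.Var) (TB : ιB → U.Var)
  (fA : ∀ j k, U.Coh (TA j) k →ₗ[ℚ] U.Coh Y k) (gA : ∀ j k, U.Coh (TA j) k →ₗ[ℚ] U.Coh P k)
  (fB : ∀ i k, U.Coh (TB i) k →ₗ[ℚ] U.Coh Y' k) (gB : ∀ i k, U.Coh (TB i) k →ₗ[ℚ] U.Coh P k)

/-- "for every block pair `(pA, pB)` — block-pair condition expressed through the given pull-back families of the
factor projections — `Φ (pA^*) (pB^*)`": the common shape of F7 and F7d. -/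
def BlockBody (Φ : (∀ k, U.Coh Y k →ₗ[ℚ] U.Coh P k) → (∀ k, U.Coh Y' k →ₗ[ℚ] U.Coh P k) → Prop) : Prop :=
  ∀ (pA : U.Mor P Y) (pB : U.Mor P Y'),
    ((∀ j k, U.pull pA k ∘ₗ fA j k = gA j k) ∧ (∀ i k, U.pull pB k ∘ₗ fB i k = gB i k)) →
      Φ (fun k => U.pull pA k) (fun k => U.pull pB k)

/-- the conclusion of F7 `Fact_gysin` over a block datum -/
def PhiGysin (α : ∀ k, U.Coh Y k →ₗ[ℚ] U.Coh P k) (β : ∀ k, U.Coh Y' k →ₗ[ℚ] U.Coh P k) : Prop :=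
  ∃ gy : (k : ℕ) → (U.Coh P (k + 2 * U.dim Y') →ₗ[ℚ] U.Coh Y k),
    (∀ (p : ℕ) (z : U.Coh P (2 * (p + U.dim Y'))), z ∈ U.alg P (p + U.dim Y') →
        gy (2 * p) (U.castCoh _ (by omega) z) ∈ U.alg Y p) ∧
    (∀ (k : ℕ) (e : U.Coh Y k) (ω : U.Coh Y' (2 * U.dim Y')),
        gy k (U.cup P k _ (α k e) (β _ ω)) = (U.tr _ _ ω) • e)

/-- the conclusion of F7d `Fact_gysinDescent` over a block datum -/
def PhiDescent (α : ∀ k, U.Coh Y k →ₗ[ℚ] U.Coh P k) (β : ∀ k, U.Coh Y' k →ₗ[ℚ] U.Coh P k) : Prop :=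
  ∀ ω : U.Coh Y' (2 * U.dim Y'), ω ≠ 0 →
    (∀ (k : ℕ) (e : U.Coh Y k), U.cup P k _ (α k e) (β _ ω) = 0 → e = 0) ∧
    (∀ (p : ℕ) (e : U.Coh Y (2 * p)),
        U.castCoh P (by omega : 2 * p + 2 * U.dim Y' = 2 * (p + U.dim Y'))
            (U.cup P (2 * p) _ (α (2 * p) e) (β _ ω)) ∈ U.alg P (p + U.dim Y') →
        e ∈ U.alg Y p)

end Bodies

/-- (Ported verbatim from the HodgeCMPerL package; no docstring in the source.) -/
theorem fact_gysin_iff_blockBody : U.Fact_gysin ↔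
    ∀ (F : CMField) (n m : ℕ) (Ξ : Fin (n + 1 + (m + 1)) → Literature.AlgebraicGeometry.Motives.CMType F),
      U.BlockBody (U.cmProd F Ξ) (U.cmProd F (blkA Ξ)) (U.cmProd F (blkB Ξ))
        (fun j => U.cmAV F (blkA Ξ j)) (fun i => U.cmAV F (blkB Ξ i))
        (fun j k => U.pull (U.prj n (fun j => U.cmAV F (blkA Ξ j)) j) k)
        (fun j k => U.pull (U.prj (n + 1 + m) (fun k => U.cmAV F (Ξ k)) (Fin.castAdd (m + 1) j)) k)
        (fun i k => U.pull (U.prj m (fun i => U.cmAV F (blkB Ξ i)) i) k)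
        (fun i k => U.pull (U.prj (n + 1 + m) (fun k => U.cmAV F (Ξ k)) (Fin.natAdd (n + 1) i)) k)
        (U.PhiGysin (U.cmProd F Ξ) (U.cmProd F (blkA Ξ)) (U.cmProd F (blkB Ξ))) :=
  Iff.rfl

/-- (Ported verbatim from the HodgeCMPerL package; no docstring in the source.) -/
theorem fact_gysinDescent_iff_blockBody : U.Fact_gysinDescent ↔
    ∀ (F : CMField) (n m : ℕ) (Ξ : Fin (n + 1 + (m + 1)) → Literature.AlgebraicGeometry.Motives.CMType F),
      U.BlockBody (U.cmProd F Ξ) (U.cmProd F (blkA Ξ)) (U.cmProd F (blkB Ξ))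
        (fun j => U.cmAV F (blkA Ξ j)) (fun i => U.cmAV F (blkB Ξ i))
        (fun j k => U.pull (U.prj n (fun j => U.cmAV F (blkA Ξ j)) j) k)
        (fun j k => U.pull (U.prj (n + 1 + m) (fun k => U.cmAV F (Ξ k)) (Fin.castAdd (m + 1) j)) k)
        (fun i k => U.pull (U.prj m (fun i => U.cmAV F (blkB Ξ i)) i) k)
        (fun i k => U.pull (U.prj (n + 1 + m) (fun k => U.cmAV F (Ξ k)) (Fin.natAdd (n + 1) i)) k)
        (U.PhiDescent (U.cmProd F Ξ) (U.cmProd F (blkA Ξ)) (U.cmProd F (blkB Ξ))) :=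
  Iff.rfl

/-- Transport of a `BlockBody` along a componentwise identification of block data. -/
theorem blockBody_congr {P P₁ Y Y₁ Y' Y'₁ : U.Var} (hP : P = P₁) (hY : Y = Y₁) (hY' : Y' = Y'₁)
    {ιA ιB : Type} {TA : ιA → U.Var} {TB : ιB → U.Var}
    {fA : ∀ j k, U.Coh (TA j) k →ₗ[ℚ] U.Coh Y k} {fA₁ : ∀ j k, U.Coh (TA j) k →ₗ[ℚ] U.Coh Y₁ k} (hfA : HEq fA fA₁)
    {gA : ∀ j k, U.Coh (TA j) k →ₗ[ℚ] U.Coh P k} {gA₁ : ∀ j k, U.Coh (TA j) k →ₗ[ℚ] U.Coh P₁ k} (hgA : HEq gA gA₁)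
    {fB : ∀ i k, U.Coh (TB i) k →ₗ[ℚ] U.Coh Y' k} {fB₁ : ∀ i k, U.Coh (TB i) k →ₗ[ℚ] U.Coh Y'₁ k} (hfB : HEq fB fB₁)
    {gB : ∀ i k, U.Coh (TB i) k →ₗ[ℚ] U.Coh P k} {gB₁ : ∀ i k, U.Coh (TB i) k →ₗ[ℚ] U.Coh P₁ k} (hgB : HEq gB gB₁)
    {Φ : (∀ k, U.Coh Y k →ₗ[ℚ] U.Coh P k) → (∀ k, U.Coh Y' k →ₗ[ℚ] U.Coh P k) → Prop}
    {Φ₁ : (∀ k, U.Coh Y₁ k →ₗ[ℚ] U.Coh P₁ k) → (∀ k, U.Coh Y'₁ k →ₗ[ℚ] U.Coh P₁ k) → Prop} (hΦ : HEq Φ Φ₁) :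
    U.BlockBody P Y Y' TA TB fA gA fB gB Φ ↔ U.BlockBody P₁ Y₁ Y'₁ TA TB fA₁ gA₁ fB₁ gB₁ Φ₁ := by
  subst hP hY hY'
  cases hfA; cases hgA; cases hfB; cases hgB; cases hΦ
  exact Iff.rfl

/-- (Ported verbatim from the HodgeCMPerL package; no docstring in the source.) -/
theorem phiGysin_heq {P P₁ Y Y₁ Y' Y'₁ : U.Var} (hP : P = P₁) (hY : Y = Y₁) (hY' : Y' = Y'₁) :
    HEq (U.PhiGysin P Y Y') (U.PhiGysin P₁ Y₁ Y'₁) := by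
  subst hP hY hY'; exact HEq.rfl

/-- (Ported verbatim from the HodgeCMPerL package; no docstring in the source.) -/
theorem phiDescent_heq {P P₁ Y Y₁ Y' Y'₁ : U.Var} (hP : P = P₁) (hY : Y = Y₁) (hY' : Y' = Y'₁) :
    HEq (U.PhiDescent P Y Y') (U.PhiDescent P₁ Y₁ Y'₁) := by
  subst hP hY hY'; exact HEq.rfl

/-- A `BlockBody` of `U` restricts to `U.restrict C` over the SAME block datum (block pairs of the restricted
universe are block pairs of `U`; `Φ` does not see morphisms). -/
theorem blockBody_restrict {P Y Y' : U.Var} {ιA ιB : Type} {TA : ιA → U.Var} {TB : ιB → U.Var}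
    {fA : ∀ j k, U.Coh (TA j) k →ₗ[ℚ] U.Coh Y k} {gA : ∀ j k, U.Coh (TA j) k →ₗ[ℚ] U.Coh P k}
    {fB : ∀ i k, U.Coh (TB i) k →ₗ[ℚ] U.Coh Y' k} {gB : ∀ i k, U.Coh (TB i) k →ₗ[ℚ] U.Coh P k}
    {Φ : (∀ k, U.Coh Y k →ₗ[ℚ] U.Coh P k) → (∀ k, U.Coh Y' k →ₗ[ℚ] U.Coh P k) → Prop}
    (h : U.BlockBody P Y Y' TA TB fA gA fB gB Φ) : (U.restrict C).BlockBody P Y Y' TA TB fA gA fB gB Φ :=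
  fun pA pB hPB => h pA.1 pB.1 hPB

/-- F7 transfers to a morphism restriction. -/
theorem restrict_fact_gysin (h : U.Fact_gysin) : (U.restrict C).Fact_gysin := by
  rw [fact_gysin_iff_blockBody] at h ⊢
  intro F n m Ξ
  exact ((U.restrict C).blockBody_congr (U.restrict_cmProd C F Ξ).symm (U.restrict_cmProd C F (blkA Ξ)).symm
    (U.restrict_cmProd C F (blkB Ξ)).symm
    (U.restrict_prjPull_heq C n (fun j => U.cmAV F (blkA Ξ j)) id).symm
    (U.restrict_prjPull_heq C (n + 1 + m) (fun k => U.cmAV F (Ξ k)) (Fin.castAdd (m + 1))).symm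
    (U.restrict_prjPull_heq C m (fun i => U.cmAV F (blkB Ξ i)) id).symm
    (U.restrict_prjPull_heq C (n + 1 + m) (fun k => U.cmAV F (Ξ k)) (fun i : Fin (m + 1) => Fin.natAdd (n + 1) i)).symm
    (U.phiGysin_heq (U.restrict_cmProd C F Ξ).symm (U.restrict_cmProd C F (blkA Ξ)).symm
      (U.restrict_cmProd C F (blkB Ξ)).symm)).mp (U.blockBody_restrict C (h F n m Ξ))

/-- F7d (M41) transfers to a morphism restriction. -/
theorem restrict_fact_gysinDescent (h : U.Fact_gysinDescent) : (U.restrict C).Fact_gysinDescent := by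
  rw [fact_gysinDescent_iff_blockBody] at h ⊢
  intro F n m Ξ
  exact ((U.restrict C).blockBody_congr (U.restrict_cmProd C F Ξ).symm (U.restrict_cmProd C F (blkA Ξ)).symm
    (U.restrict_cmProd C F (blkB Ξ)).symm
    (U.restrict_prjPull_heq C n (fun j => U.cmAV F (blkA Ξ j)) id).symm
    (U.restrict_prjPull_heq C (n + 1 + m) (fun k => U.cmAV F (Ξ k)) (Fin.castAdd (m + 1))).symm
    (U.restrict_prjPull_heq C m (fun i => U.cmAV F (blkB Ξ i)) id).symm
    (U.restrict_prjPull_heq C (n + 1 + m) (fun k => U.cmAV F (Ξ k)) (fun i : Fin (m + 1) => Fin.natAdd (n + 1) i)).symm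
    (U.phiDescent_heq (U.restrict_cmProd C F Ξ).symm (U.restrict_cmProd C F (blkA Ξ)).symm
      (U.restrict_cmProd C F (blkB Ξ)).symm)).mp (U.blockBody_restrict C (h F n m Ξ))

/-! ### The body of F2 `Fact_factorActDescends` -/

section F2

variable (F : CMField) {n m : ℕ} (Ξ : Fin (n + 1 + (m + 1)) → Literature.AlgebraicGeometry.Motives.CMType F)

/-- "`μ` is the CM multiplication by `a` on the `j`-th factor and the identity on the others", through a given
degree-one pull-back family `q` of the factor projections (the body of `IsFactorAct`, with `μ = M^*`). -/
def FABody {ι : Type} (Θ : ι → Literature.AlgebraicGeometry.Motives.CMType F) (Q : U.Var)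
    (q : ∀ i, U.Coh (U.cmAV F (Θ i)) 1 →ₗ[ℚ] U.Coh Q 1) (j : ι) (a : F) (μ : U.Coh Q 1 →ₗ[ℚ] U.Coh Q 1) : Prop :=
  μ ∘ₗ q j = q j ∘ₗ ((U.cmAct F (Θ j)).ι a : _ →ₗ[ℚ] _) ∧ ∀ i, i ≠ j → μ ∘ₗ q i = q i

/-- the body of F2 over a block datum and the degree-one projection families `qP, qA, qB` -/
def F2Body (P Y Y' : U.Var)
    (fA : ∀ (j : Fin (n + 1)) k, U.Coh (U.cmAV F (blkA Ξ j)) k →ₗ[ℚ] U.Coh Y k)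
    (gA : ∀ (j : Fin (n + 1)) k, U.Coh (U.cmAV F (blkA Ξ j)) k →ₗ[ℚ] U.Coh P k)
    (fB : ∀ (i : Fin (m + 1)) k, U.Coh (U.cmAV F (blkB Ξ i)) k →ₗ[ℚ] U.Coh Y' k)
    (gB : ∀ (i : Fin (m + 1)) k, U.Coh (U.cmAV F (blkB Ξ i)) k →ₗ[ℚ] U.Coh P k)
    (qP : ∀ i : Fin (n + 1 + m + 1), U.Coh (U.cmAV F (Ξ i)) 1 →ₗ[ℚ] U.Coh P 1)
    (qA : ∀ j : Fin (n + 1), U.Coh (U.cmAV F (blkA Ξ j)) 1 →ₗ[ℚ] U.Coh Y 1)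
    (qB : ∀ i : Fin (m + 1), U.Coh (U.cmAV F (blkB Ξ i)) 1 →ₗ[ℚ] U.Coh Y' 1) : Prop :=
  ∀ (pA : U.Mor P Y) (pB : U.Mor P Y'),
    ((∀ j k, U.pull pA k ∘ₗ fA j k = gA j k) ∧ (∀ i k, U.pull pB k ∘ₗ fB i k = gB i k)) →
    ∀ (a : F) (M : U.Mor P P),
      (∀ j : Fin (n + 1), U.FABody F Ξ P qP (Fin.castAdd (m + 1) j) a (U.pull M 1) →
        (∃ MA : U.Mor Y Y, U.FABody F (blkA Ξ) Y qA j a (U.pull MA 1) ∧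
            ∀ k : ℕ, U.pull M k ∘ₗ U.pull pA k = U.pull pA k ∘ₗ U.pull MA k) ∧
        ∀ k : ℕ, U.pull M k ∘ₗ U.pull pB k = U.pull pB k) ∧
      (∀ i : Fin (m + 1), U.FABody F Ξ P qP (Fin.natAdd (n + 1) i) a (U.pull M 1) →
        (∃ MB : U.Mor Y' Y', U.FABody F (blkB Ξ) Y' qB i a (U.pull MB 1) ∧
            ∀ k : ℕ, U.pull M k ∘ₗ U.pull pB k = U.pull pB k ∘ₗ U.pull MB k) ∧
        ∀ k : ℕ, U.pull M k ∘ₗ U.pull pA k = U.pull pA k)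

/-- (Ported verbatim from the HodgeCMPerL package; no docstring in the source.) -/
theorem f2Body_congr {P P₁ Y Y₁ Y' Y'₁ : U.Var} (hP : P = P₁) (hY : Y = Y₁) (hY' : Y' = Y'₁)
    {fA : ∀ (j : Fin (n + 1)) k, U.Coh (U.cmAV F (blkA Ξ j)) k →ₗ[ℚ] U.Coh Y k}
    {fA₁ : ∀ (j : Fin (n + 1)) k, U.Coh (U.cmAV F (blkA Ξ j)) k →ₗ[ℚ] U.Coh Y₁ k} (hfA : HEq fA fA₁)
    {gA : ∀ (j : Fin (n + 1)) k, U.Coh (U.cmAV F (blkA Ξ j)) k →ₗ[ℚ] U.Coh P k}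
    {gA₁ : ∀ (j : Fin (n + 1)) k, U.Coh (U.cmAV F (blkA Ξ j)) k →ₗ[ℚ] U.Coh P₁ k} (hgA : HEq gA gA₁)
    {fB : ∀ (i : Fin (m + 1)) k, U.Coh (U.cmAV F (blkB Ξ i)) k →ₗ[ℚ] U.Coh Y' k}
    {fB₁ : ∀ (i : Fin (m + 1)) k, U.Coh (U.cmAV F (blkB Ξ i)) k →ₗ[ℚ] U.Coh Y'₁ k} (hfB : HEq fB fB₁)
    {gB : ∀ (i : Fin (m + 1)) k, U.Coh (U.cmAV F (blkB Ξ i)) k →ₗ[ℚ] U.Coh P k}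
    {gB₁ : ∀ (i : Fin (m + 1)) k, U.Coh (U.cmAV F (blkB Ξ i)) k →ₗ[ℚ] U.Coh P₁ k} (hgB : HEq gB gB₁)
    {qP : ∀ i : Fin (n + 1 + m + 1), U.Coh (U.cmAV F (Ξ i)) 1 →ₗ[ℚ] U.Coh P 1}
    {qP₁ : ∀ i : Fin (n + 1 + m + 1), U.Coh (U.cmAV F (Ξ i)) 1 →ₗ[ℚ] U.Coh P₁ 1} (hqP : HEq qP qP₁)
    {qA : ∀ j : Fin (n + 1), U.Coh (U.cmAV F (blkA Ξ j)) 1 →ₗ[ℚ] U.Coh Y 1}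
    {qA₁ : ∀ j : Fin (n + 1), U.Coh (U.cmAV F (blkA Ξ j)) 1 →ₗ[ℚ] U.Coh Y₁ 1} (hqA : HEq qA qA₁)
    {qB : ∀ i : Fin (m + 1), U.Coh (U.cmAV F (blkB Ξ i)) 1 →ₗ[ℚ] U.Coh Y' 1}
    {qB₁ : ∀ i : Fin (m + 1), U.Coh (U.cmAV F (blkB Ξ i)) 1 →ₗ[ℚ] U.Coh Y'₁ 1} (hqB : HEq qB qB₁) :
    U.F2Body F Ξ P Y Y' fA gA fB gB qP qA qB ↔ U.F2Body F Ξ P₁ Y₁ Y'₁ fA₁ gA₁ fB₁ gB₁ qP₁ qA₁ qB₁ := by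
  subst hP hY hY'
  cases hfA; cases hgA; cases hfB; cases hgB; cases hqP; cases hqA; cases hqB
  exact Iff.rfl

/-- (Ported verbatim from the HodgeCMPerL package; no docstring in the source.) -/
theorem fact_factorActDescends_iff_f2Body : U.Fact_factorActDescends ↔
    ∀ (F : CMField) (n m : ℕ) (Ξ : Fin (n + 1 + (m + 1)) → Literature.AlgebraicGeometry.Motives.CMType F),
      U.F2Body F Ξ (U.cmProd F Ξ) (U.cmProd F (blkA Ξ)) (U.cmProd F (blkB Ξ))
        (fun j k => U.pull (U.prj n (fun j => U.cmAV F (blkA Ξ j)) j) k)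
        (fun j k => U.pull (U.prj (n + 1 + m) (fun k => U.cmAV F (Ξ k)) (Fin.castAdd (m + 1) j)) k)
        (fun i k => U.pull (U.prj m (fun i => U.cmAV F (blkB Ξ i)) i) k)
        (fun i k => U.pull (U.prj (n + 1 + m) (fun k => U.cmAV F (Ξ k)) (Fin.natAdd (n + 1) i)) k)
        (fun i => U.pull (U.prj (n + 1 + m) (fun k => U.cmAV F (Ξ k)) i) 1)
        (fun j => U.pull (U.prj n (fun j => U.cmAV F (blkA Ξ j)) j) 1)
        (fun i => U.pull (U.prj m (fun i => U.cmAV F (blkB Ξ i)) i) 1) :=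
  Iff.rfl

variable {F Ξ}

/-- An `F2Body` of `U` restricts to `U.restrict C` over the same data, provided every endomorphism of the two blocks
lies in the class (the descended factor actions must be morphisms of the restricted universe). -/
theorem f2Body_restrict {P Y Y' : U.Var}
    {fA : ∀ (j : Fin (n + 1)) k, U.Coh (U.cmAV F (blkA Ξ j)) k →ₗ[ℚ] U.Coh Y k}
    {gA : ∀ (j : Fin (n + 1)) k, U.Coh (U.cmAV F (blkA Ξ j)) k →ₗ[ℚ] U.Coh P k}
    {fB : ∀ (i : Fin (m + 1)) k, U.Coh (U.cmAV F (blkB Ξ i)) k →ₗ[ℚ] U.Coh Y' k}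
    {gB : ∀ (i : Fin (m + 1)) k, U.Coh (U.cmAV F (blkB Ξ i)) k →ₗ[ℚ] U.Coh P k}
    {qP : ∀ i : Fin (n + 1 + m + 1), U.Coh (U.cmAV F (Ξ i)) 1 →ₗ[ℚ] U.Coh P 1}
    {qA : ∀ j : Fin (n + 1), U.Coh (U.cmAV F (blkA Ξ j)) 1 →ₗ[ℚ] U.Coh Y 1}
    {qB : ∀ i : Fin (m + 1), U.Coh (U.cmAV F (blkB Ξ i)) 1 →ₗ[ℚ] U.Coh Y' 1}
    (hY : ∀ f : U.Mor Y Y, C.P f) (hY' : ∀ f : U.Mor Y' Y', C.P f)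
    (h : U.F2Body F Ξ P Y Y' fA gA fB gB qP qA qB) :
    (U.restrict C).F2Body F Ξ P Y Y' fA gA fB gB qP qA qB := by
  intro pA pB hPB a M
  obtain ⟨h1, h2⟩ := h pA.1 pB.1 hPB a M.1
  refine ⟨fun j hj => ?_, fun i hi => ?_⟩
  · obtain ⟨⟨MA, hMA, hc⟩, hB⟩ := h1 j hj
    exact ⟨⟨⟨MA, hY MA⟩, hMA, hc⟩, hB⟩
  · obtain ⟨⟨MB, hMB, hc⟩, hA⟩ := h2 i hi
    exact ⟨⟨⟨MB, hY' MB⟩, hMB, hc⟩, hA⟩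

end F2

/-- F2 transfers to a morphism restriction whose class contains every endomorphism of every CM product. -/
theorem restrict_fact_factorActDescends
    (hC : ∀ (F : CMField) (n : ℕ) (Θ : Fin (n + 1) → Literature.AlgebraicGeometry.Motives.CMType F)
      (f : U.Mor (U.cmProd F Θ) (U.cmProd F Θ)), C.P f)
    (h : U.Fact_factorActDescends) : (U.restrict C).Fact_factorActDescends := by
  rw [fact_factorActDescends_iff_f2Body] at h ⊢
  intro F n m Ξ
  exact ((U.restrict C).f2Body_congr F Ξ (U.restrict_cmProd C F Ξ).symm (U.restrict_cmProd C F (blkA Ξ)).symm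
    (U.restrict_cmProd C F (blkB Ξ)).symm
    (U.restrict_prjPull_heq C n (fun j => U.cmAV F (blkA Ξ j)) id).symm
    (U.restrict_prjPull_heq C (n + 1 + m) (fun k => U.cmAV F (Ξ k)) (Fin.castAdd (m + 1))).symm
    (U.restrict_prjPull_heq C m (fun i => U.cmAV F (blkB Ξ i)) id).symm
    (U.restrict_prjPull_heq C (n + 1 + m) (fun k => U.cmAV F (Ξ k)) (fun i : Fin (m + 1) => Fin.natAdd (n + 1) i)).symm
    (U.restrict_prjPull_heq₁ C (n + 1 + m) (fun k => U.cmAV F (Ξ k)) 1).symm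
    (U.restrict_prjPull_heq₁ C n (fun j => U.cmAV F (blkA Ξ j)) 1).symm
    (U.restrict_prjPull_heq₁ C m (fun i => U.cmAV F (blkB Ξ i)) 1).symm).mp
    (U.f2Body_restrict C (hC F n (blkA Ξ)) (hC F m (blkB Ξ)) (h F n m Ξ))

end Universe

/-! ### The tagged toy universe -/

namespace Toy

open CMInflationIndependent GaloisClosure

variable (D : HodgeData)

/-- All atoms of an iterated product of single-tagged objects carry that tag. -/
theorem tag_prodFin (τ₀ : IntermediateField ℚ ℂ) :
    ∀ (n : ℕ) (X : Fin (n + 1) → Obj), (∀ j i, tagOf ((X j).atom i).F = τ₀) →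
      ∀ i, tagOf ((((toyModelWith D).prodFin n X).atom i).F) = τ₀
  | 0, _, h => h 0
  | n + 1, X, h => by
    show ∀ i : (((toyModelWith D).prodFin n (fun i => X i.castSucc)).prod (X (Fin.last (n + 1)))).s.toType, _
    rintro (i | i)
    · exact tag_prodFin τ₀ n _ (fun j => h j.castSucc) i
    · exact h (Fin.last (n + 1)) i

/-- Every lattice map between CM products `∏_j A_{(F,Θ_j)}`, `∏_i A_{(F,Θ'_i)}` over one CM field is tagged. -/
theorem tagged_cmProd (F : CMField) {n n' : ℕ} (Θ : Fin (n + 1) → Literature.AlgebraicGeometry.Motives.CMType F)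
    (Θ' : Fin (n' + 1) → Literature.AlgebraicGeometry.Motives.CMType F)
    (f : (toyModelWith D).Mor ((toyModelWith D).cmProd F Θ) ((toyModelWith D).cmProd F Θ')) : Tagged f :=
  tagged_of_const f (N F) (tag_prodFin D (N F) n _ fun j u => tag_cmObj F (Θ j) u)
    (tag_prodFin D (N F) n' _ fun i u => tag_cmObj F (Θ' i) u)

/-- The tagged exterior toy universe satisfies the block facts F2, F7, F7d (M41). -/
theorem tagModel_blocks :
    (tagModel exteriorHodgeData).Fact_factorActDescends ∧ (tagModel exteriorHodgeData).Fact_gysin ∧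
      (tagModel exteriorHodgeData).Fact_gysinDescent :=
  ⟨(toyModelWith exteriorHodgeData).restrict_fact_factorActDescends _
      (fun F _ Θ f => tagged_cmProd exteriorHodgeData F Θ Θ f) (fact_factorActDescends exteriorHodgeData),
    (toyModelWith exteriorHodgeData).restrict_fact_gysin _ (fact_gysin exteriorHodgeData),
    (toyModelWith exteriorHodgeData).restrict_fact_gysinDescent _ fact_gysinDescent⟩

/-- **M38 is independent of M1–M28 ∧ N1–N4 ∧ F2 ∧ F4 ∧ F5 ∧ F7 ∧ F7d (M41) ∧ D (M40) ∧ `Fact_H0_rank` (M42),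
jointly** — of every candidate model fact of `HOME/FACTS.md` §1c that holds in the exterior toy universe. -/
theorem cmInflation_independent_blocks :
    ∃ U : Universe, (U.ModelAxioms ∧ U.Fact_cupExterior ∧ U.Fact_cup_hodge ∧ U.Fact_pull_H0 ∧ U.Fact_hodge_F0 ∧
      U.Fact_factorActDescends ∧ U.Fact_cupAlg ∧ U.Fact_cupAssoc ∧ U.Fact_gysin ∧ U.Fact_gysinDescent ∧
      U.Fact_dimProd ∧ U.Fact_H0_rank) ∧ ¬ U.Fact_cmInflation :=
  have h := tagModel_ledger
  have b := tagModel_blocks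
  ⟨tagModel exteriorHodgeData, ⟨h.1, h.2.1, h.2.2.1, h.2.2.2.1, h.2.2.2.2.1, b.1, h.2.2.2.2.2.1, h.2.2.2.2.2.2.1, b.2.1,
    b.2.2, h.2.2.2.2.2.2.2.1, h.2.2.2.2.2.2.2.2⟩, not_fact_cmInflation exteriorHodgeData⟩

/-! Axiom closures of `HodgeCM.Toy.cmInflation_independent_blocks`, `HodgeCM.Toy.tagModel_blocks`,
`HodgeCM.Universe.restrict_fact_gysinDescent` (expected: `propext`, `Classical.choice`, `Quot.sound`). -/

end Toy

end HodgeCM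

end
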